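import Summits.CriticalPhenomena.PercolationContinuityZ3.Theorems.PercNearOneGluingNoHeavyLowerTailCovTriangleTyped
import Literature.Probability.LatticeModels.SahiThirdOrderCorrelation
import HarnessLib

/-!
# `NoHeavyLowerTail` (stmt-CriticalPhenomena-4575) — the G⁺ functional `E₃(Uᶜ, Aᶜ, Bᶜ)` as "Harris slacks minus the BHK deficit" (exact identity)

Support file (prover prim-facecert gen 11; `--supports stmt-CriticalPhenomena-4575`).  No definitions, no named facts, no sorries.

For ANY probability measure `μ` and events `U, A, B` (write `D = Uᶜ`), Sahi's third-order functional (tree `sahiE3`) satisfies the exact identity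

  `μ(D) · E₃(D, Aᶜ, Bᶜ)  =  μ(D)·H'  +  Cov(U,A)·Cov(U,B)  −  Δ*`,

  `H'  := μ(U)μ(Aᶜ∩Bᶜ) − μ(U∩(Aᶜ∩Bᶜ))`            (Harris slack of the increasing `U` against the decreasing `Aᶜ∩Bᶜ`),
  `Cov(U,A) := μ(U∩A) − μ(U)μ(A)`, `Cov(U,B) := μ(U∩B) − μ(U)μ(B)`   (Harris slacks),
  `Δ*  := μ(D∩A)μ(D∩B) − μ(D)μ(D∩A∩B)`                (van den Berg–Häggström–Kahn two-set deficit)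

(`sahiE3_compl_mul_eq`; seven atoms + `ring`).  Consequences recorded here:
* `quantBHK_of_sahiE3_nonneg` / `sahiE3_nonneg_of_quantBHK`:  `0 ≤ E₃(Uᶜ,Aᶜ,Bᶜ)  ⟺  Δ* ≤ μ(Uᶜ)·H' + Cov(U,A)·Cov(U,B)` (the backward direction
  also in the degenerate case `μ(Uᶜ) = 0`).  In percolation (`U = {S ~ T}`, `A` cluster-monotone in `C_S`, `B` in `C_T`) the left side is
  prim-ineq-prove-3's Conjecture G⁺ (`FrontierDecRows.ClusterBHK3Pos`, which implies the open dec rows 36/44/15/12/27/30), and all four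
  quantities `H', Cov(U,A), Cov(U,B), Δ*` are nonnegative theorems (`prodBernoulli_harris(_upper_lower)`, `setTwoClusterExchange`): G⁺ is
  EXACTLY the quantitative BHK statement "deficit ≤ μ(D)·H' + Cov·Cov" (kernel form of the lead's numerically verified `G⁺ ⟺ QBHK`).
* `covTriangleExpr_eq`: the covariance-triangle expression of `…CovTriangleOfR2` equals `μ(D)·E₃(D,Aᶜ,Bᶜ) + 2Δ*`, so G⁺ ⟹ CT with room `2Δ*`
  (CT itself is the unconditional theorem `CovTrianglePath.covTriangle_typed`).
-/

noncomputable section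

namespace Summit.CriticalPhenomena.PercolationContinuityZ3.Theorems

namespace CovTrianglePath

open MeasureTheory Set
open Literature.Probability.LatticeModels (sahiE3)

/-- **`μ(Uᶜ)·E₃(Uᶜ,Aᶜ,Bᶜ) = μ(Uᶜ)·H' + Cov(U,A)Cov(U,B) − Δ*`** for every probability measure (see the file docstring for the names).
[this work] -/
theorem sahiE3_compl_mul_eq {Ω : Type*} [MeasurableSpace Ω] (μ : Measure Ω) [IsProbabilityMeasure μ] {U A B : Set Ω}
    (hU : MeasurableSet U) (hA : MeasurableSet A) (hB : MeasurableSet B) :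
    μ.real Uᶜ * sahiE3 μ Uᶜ Aᶜ Bᶜ =
      μ.real Uᶜ * (μ.real U * μ.real (Aᶜ ∩ Bᶜ) - μ.real (U ∩ (Aᶜ ∩ Bᶜ))) +
        (μ.real (U ∩ A) - μ.real U * μ.real A) * (μ.real (U ∩ B) - μ.real U * μ.real B) -
        (μ.real (Uᶜ ∩ A) * μ.real (Uᶜ ∩ B) - μ.real Uᶜ * μ.real (Uᶜ ∩ A ∩ B)) := by
  -- atoms: u = μU, μ(U∩A), μ(Uᶜ∩A), μ(U∩B), μ(Uᶜ∩B), μ(U∩A∩B), μ(Uᶜ∩A∩B)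
  have eD : μ.real Uᶜ = 1 - μ.real U := probReal_compl_eq_one_sub hU
  have eAc : μ.real Aᶜ = 1 - μ.real A := probReal_compl_eq_one_sub hA
  have eBc : μ.real Bᶜ = 1 - μ.real B := probReal_compl_eq_one_sub hB
  have eA : μ.real A = μ.real (U ∩ A) + μ.real (Uᶜ ∩ A) := by
    have h := measureReal_inter_add_sdiff (μ := μ) (s := A) hU
    rw [Set.sdiff_eq, Set.inter_comm A U, Set.inter_comm A Uᶜ] at h
    linarith
  have eB : μ.real B = μ.real (U ∩ B) + μ.real (Uᶜ ∩ B) := by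
    have h := measureReal_inter_add_sdiff (μ := μ) (s := B) hU
    rw [Set.sdiff_eq, Set.inter_comm B U, Set.inter_comm B Uᶜ] at h
    linarith
  have eAB : μ.real (A ∩ B) = μ.real (U ∩ A ∩ B) + μ.real (Uᶜ ∩ A ∩ B) := by
    have h := measureReal_inter_add_sdiff (μ := μ) (s := A ∩ B) hU
    rw [Set.sdiff_eq, Set.inter_comm (A ∩ B) U, Set.inter_comm (A ∩ B) Uᶜ, ← Set.inter_assoc, ← Set.inter_assoc] at h
    linarith
  -- complements inside intersections
  have eAcBc : μ.real (Aᶜ ∩ Bᶜ) = μ.real Aᶜ - μ.real (Aᶜ ∩ B) := by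
    have h := measureReal_inter_add_sdiff (μ := μ) (s := Aᶜ) hB
    rw [Set.sdiff_eq] at h
    linarith
  have eAcB : μ.real (Aᶜ ∩ B) = μ.real B - μ.real (A ∩ B) := by
    have h := measureReal_inter_add_sdiff (μ := μ) (s := B) hA
    rw [Set.sdiff_eq, Set.inter_comm B A, Set.inter_comm B Aᶜ] at h
    linarith
  have eUAcBc : μ.real (U ∩ (Aᶜ ∩ Bᶜ)) = μ.real (U ∩ Aᶜ) - μ.real (U ∩ Aᶜ ∩ B) := by
    have h := measureReal_inter_add_sdiff (μ := μ) (s := U ∩ Aᶜ) hB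
    rw [Set.sdiff_eq, Set.inter_assoc U Aᶜ Bᶜ] at h
    linarith
  have eUAc : μ.real (U ∩ Aᶜ) = μ.real U - μ.real (U ∩ A) := by
    have h := measureReal_inter_add_sdiff (μ := μ) (s := U) hA
    rw [Set.sdiff_eq] at h
    linarith
  have eUAcB : μ.real (U ∩ Aᶜ ∩ B) = μ.real (U ∩ B) - μ.real (U ∩ A ∩ B) := by
    have h := measureReal_inter_add_sdiff (μ := μ) (s := U ∩ B) hA
    rw [Set.sdiff_eq, Set.inter_right_comm U B A, Set.inter_right_comm U B Aᶜ] at h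
    linarith
  have eDAcBc : μ.real (Uᶜ ∩ Aᶜ ∩ Bᶜ) = μ.real (Uᶜ ∩ Aᶜ) - μ.real (Uᶜ ∩ Aᶜ ∩ B) := by
    have h := measureReal_inter_add_sdiff (μ := μ) (s := Uᶜ ∩ Aᶜ) hB
    rw [Set.sdiff_eq] at h
    linarith
  have eDAc : μ.real (Uᶜ ∩ Aᶜ) = μ.real Uᶜ - μ.real (Uᶜ ∩ A) := by
    have h := measureReal_inter_add_sdiff (μ := μ) (s := Uᶜ) hA
    rw [Set.sdiff_eq] at h
    linarith
  have eDBc : μ.real (Uᶜ ∩ Bᶜ) = μ.real Uᶜ - μ.real (Uᶜ ∩ B) := by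
    have h := measureReal_inter_add_sdiff (μ := μ) (s := Uᶜ) hB
    rw [Set.sdiff_eq] at h
    linarith
  have eDAcB : μ.real (Uᶜ ∩ Aᶜ ∩ B) = μ.real (Uᶜ ∩ B) - μ.real (Uᶜ ∩ A ∩ B) := by
    have h := measureReal_inter_add_sdiff (μ := μ) (s := Uᶜ ∩ B) hA
    rw [Set.sdiff_eq, Set.inter_right_comm Uᶜ B A, Set.inter_right_comm Uᶜ B Aᶜ] at h
    linarith
  unfold sahiE3
  rw [eDAcBc, eDAc, eDAcB, eDBc, eUAcBc, eUAc, eUAcB, eAcBc, eAcB, eAc, eBc, eAB, eA, eB, eD]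
  ring

/-- **G⁺ ⟹ quantitative BHK**: `0 ≤ E₃(Uᶜ,Aᶜ,Bᶜ)` gives `Δ* ≤ μ(Uᶜ)·H' + Cov(U,A)·Cov(U,B)`. [this work] -/
theorem quantBHK_of_sahiE3_nonneg {Ω : Type*} [MeasurableSpace Ω] (μ : Measure Ω) [IsProbabilityMeasure μ] {U A B : Set Ω}
    (hU : MeasurableSet U) (hA : MeasurableSet A) (hB : MeasurableSet B) (h : 0 ≤ sahiE3 μ Uᶜ Aᶜ Bᶜ) :
    μ.real (Uᶜ ∩ A) * μ.real (Uᶜ ∩ B) - μ.real Uᶜ * μ.real (Uᶜ ∩ A ∩ B) ≤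
      μ.real Uᶜ * (μ.real U * μ.real (Aᶜ ∩ Bᶜ) - μ.real (U ∩ (Aᶜ ∩ Bᶜ))) +
        (μ.real (U ∩ A) - μ.real U * μ.real A) * (μ.real (U ∩ B) - μ.real U * μ.real B) := by
  have hid := sahiE3_compl_mul_eq μ hU hA hB
  have hm : 0 ≤ μ.real Uᶜ * sahiE3 μ Uᶜ Aᶜ Bᶜ := mul_nonneg measureReal_nonneg h
  linarith

/-- **Quantitative BHK ⟹ G⁺**: `Δ* ≤ μ(Uᶜ)·H' + Cov(U,A)·Cov(U,B)` gives `0 ≤ E₃(Uᶜ,Aᶜ,Bᶜ)` (the degenerate case `μ(Uᶜ) = 0` is handled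
separately: then `E₃(Uᶜ,·,·) = 0`). [this work] -/
theorem sahiE3_nonneg_of_quantBHK {Ω : Type*} [MeasurableSpace Ω] (μ : Measure Ω) [IsProbabilityMeasure μ] {U A B : Set Ω}
    (hU : MeasurableSet U) (hA : MeasurableSet A) (hB : MeasurableSet B)
    (h : μ.real (Uᶜ ∩ A) * μ.real (Uᶜ ∩ B) - μ.real Uᶜ * μ.real (Uᶜ ∩ A ∩ B) ≤
      μ.real Uᶜ * (μ.real U * μ.real (Aᶜ ∩ Bᶜ) - μ.real (U ∩ (Aᶜ ∩ Bᶜ))) +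
        (μ.real (U ∩ A) - μ.real U * μ.real A) * (μ.real (U ∩ B) - μ.real U * μ.real B)) :
    0 ≤ sahiE3 μ Uᶜ Aᶜ Bᶜ := by
  have hid := sahiE3_compl_mul_eq μ hU hA hB
  rcases (measureReal_nonneg : 0 ≤ μ.real Uᶜ).eq_or_lt with hz | hpos
  · -- μ(Uᶜ) = 0: every mass inside Uᶜ vanishes and E₃(Uᶜ, ·, ·) = 0
    have h0 : μ.real Uᶜ = 0 := hz.symm
    have h1 : μ.real (Uᶜ ∩ Aᶜ ∩ Bᶜ) = 0 :=
      le_antisymm (h0 ▸ measureReal_mono (by intro x hx; exact hx.1.1)) measureReal_nonneg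
    have h2 : μ.real (Uᶜ ∩ Aᶜ) = 0 :=
      le_antisymm (h0 ▸ measureReal_mono Set.inter_subset_left) measureReal_nonneg
    have h3 : μ.real (Uᶜ ∩ Bᶜ) = 0 :=
      le_antisymm (h0 ▸ measureReal_mono Set.inter_subset_left) measureReal_nonneg
    unfold sahiE3
    rw [h0, h1, h2, h3]
    simp
  · have hm : 0 ≤ μ.real Uᶜ * sahiE3 μ Uᶜ Aᶜ Bᶜ := by linarith [hid]
    exact (mul_nonneg_iff_of_pos_left hpos).mp hm

/-- **The covariance-triangle expression is `μ(D)·E₃(D,Aᶜ,Bᶜ) + 2Δ*`** (`D = Uᶜ`): so G⁺ implies CT with room `2Δ* ≥ 0`, and CT (the theorem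
`covTriangle_typed`) is G⁺ weakened by exactly twice the BHK deficit. [this work] -/
theorem covTriangleExpr_eq {Ω : Type*} [MeasurableSpace Ω] (μ : Measure Ω) [IsProbabilityMeasure μ] {U A B : Set Ω}
    (hU : MeasurableSet U) (hA : MeasurableSet A) (hB : MeasurableSet B) :
    μ.real (Uᶜ ∩ Bᶜ) * (μ.real (U ∩ A) - μ.real U * μ.real A) +
        μ.real (Uᶜ ∩ Aᶜ) * (μ.real (U ∩ B) - μ.real U * μ.real B) -
        μ.real Uᶜ ^ 2 * (μ.real (A ∩ B) - μ.real A * μ.real B) =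
      μ.real Uᶜ * sahiE3 μ Uᶜ Aᶜ Bᶜ +
        2 * (μ.real (Uᶜ ∩ A) * μ.real (Uᶜ ∩ B) - μ.real Uᶜ * μ.real (Uᶜ ∩ A ∩ B)) := by
  rw [sahiE3_compl_mul_eq μ hU hA hB]
  have eD : μ.real Uᶜ = 1 - μ.real U := probReal_compl_eq_one_sub hU
  have eA : μ.real A = μ.real (U ∩ A) + μ.real (Uᶜ ∩ A) := by
    have h := measureReal_inter_add_sdiff (μ := μ) (s := A) hU
    rw [Set.sdiff_eq, Set.inter_comm A U, Set.inter_comm A Uᶜ] at h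
    linarith
  have eB : μ.real B = μ.real (U ∩ B) + μ.real (Uᶜ ∩ B) := by
    have h := measureReal_inter_add_sdiff (μ := μ) (s := B) hU
    rw [Set.sdiff_eq, Set.inter_comm B U, Set.inter_comm B Uᶜ] at h
    linarith
  have eAB : μ.real (A ∩ B) = μ.real (U ∩ A ∩ B) + μ.real (Uᶜ ∩ A ∩ B) := by
    have h := measureReal_inter_add_sdiff (μ := μ) (s := A ∩ B) hU
    rw [Set.sdiff_eq, Set.inter_comm (A ∩ B) U, Set.inter_comm (A ∩ B) Uᶜ, ← Set.inter_assoc, ← Set.inter_assoc] at h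
    linarith
  have eAcBc : μ.real (Aᶜ ∩ Bᶜ) = μ.real (U ∩ Aᶜ ∩ Bᶜ) + μ.real (Uᶜ ∩ Aᶜ ∩ Bᶜ) := by
    have h := measureReal_inter_add_sdiff (μ := μ) (s := Aᶜ ∩ Bᶜ) hU
    rw [Set.sdiff_eq, Set.inter_comm (Aᶜ ∩ Bᶜ) U, Set.inter_comm (Aᶜ ∩ Bᶜ) Uᶜ, ← Set.inter_assoc,
      ← Set.inter_assoc] at h
    linarith
  have eUE : μ.real (U ∩ (Aᶜ ∩ Bᶜ)) = μ.real (U ∩ Aᶜ ∩ Bᶜ) := by rw [← Set.inter_assoc]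
  have eUAcBc : μ.real (U ∩ Aᶜ ∩ Bᶜ) = μ.real (U ∩ Aᶜ) - μ.real (U ∩ Aᶜ ∩ B) := by
    have h := measureReal_inter_add_sdiff (μ := μ) (s := U ∩ Aᶜ) hB
    rw [Set.sdiff_eq] at h
    linarith
  have eUAc : μ.real (U ∩ Aᶜ) = μ.real U - μ.real (U ∩ A) := by
    have h := measureReal_inter_add_sdiff (μ := μ) (s := U) hA
    rw [Set.sdiff_eq] at h
    linarith
  have eUAcB : μ.real (U ∩ Aᶜ ∩ B) = μ.real (U ∩ B) - μ.real (U ∩ A ∩ B) := by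
    have h := measureReal_inter_add_sdiff (μ := μ) (s := U ∩ B) hA
    rw [Set.sdiff_eq, Set.inter_right_comm U B A, Set.inter_right_comm U B Aᶜ] at h
    linarith
  have eDAcBc : μ.real (Uᶜ ∩ Aᶜ ∩ Bᶜ) = μ.real (Uᶜ ∩ Aᶜ) - μ.real (Uᶜ ∩ Aᶜ ∩ B) := by
    have h := measureReal_inter_add_sdiff (μ := μ) (s := Uᶜ ∩ Aᶜ) hB
    rw [Set.sdiff_eq] at h
    linarith
  have eDAc : μ.real (Uᶜ ∩ Aᶜ) = μ.real Uᶜ - μ.real (Uᶜ ∩ A) := by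
    have h := measureReal_inter_add_sdiff (μ := μ) (s := Uᶜ) hA
    rw [Set.sdiff_eq] at h
    linarith
  have eDBc : μ.real (Uᶜ ∩ Bᶜ) = μ.real Uᶜ - μ.real (Uᶜ ∩ B) := by
    have h := measureReal_inter_add_sdiff (μ := μ) (s := Uᶜ) hB
    rw [Set.sdiff_eq] at h
    linarith
  have eDAcB : μ.real (Uᶜ ∩ Aᶜ ∩ B) = μ.real (Uᶜ ∩ B) - μ.real (Uᶜ ∩ A ∩ B) := by
    have h := measureReal_inter_add_sdiff (μ := μ) (s := Uᶜ ∩ B) hA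
    rw [Set.sdiff_eq, Set.inter_right_comm Uᶜ B A, Set.inter_right_comm Uᶜ B Aᶜ] at h
    linarith
  rw [eUE, eAcBc, eUAcBc, eUAc, eUAcB, eDAcBc, eDAc, eDAcB, eDBc, eAB, eA, eB, eD]
  ring

end CovTrianglePath

end Summit.CriticalPhenomena.PercolationContinuityZ3.Theorems
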